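import Literature.NumberTheory.Automorphic.TorusCenterSpan
import Literature.NumberTheory.Automorphic.CentralizerTorusConnected
import Literature.NumberTheory.Automorphic.ReductiveDualRankOne
import HarnessLib

/-!
# An element of `G` centralising all root `SL₂`'s lies in the maximal torus
(trunk T-AUTOMORPHIC, G25 AutomorphicL; tool for the graph proof of `chevalley_isomorphism(_abstract)`,
Springer 9.6.2: the kernel `{g' | (1, g') ∈ H}` of the graph group lies in `T'`)

Let `(G, T)` be connected reductive with root datum `P` over an algebraically closed field of
characteristic `0` (`h : IsRootDatumOf G T P eX eY`), with the realisations `φ_i : SL₂ → G` of the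
roots (`h.rootSL2 i`, `RootSl2Triples.lean`).

* `corootTwist h b : T →* T`, `t ↦ ∏_{j ∈ b} α_j^∨ (χ_{α_j} (t))` for a base `b` of `P`, an algebraic
  endomorphism of `T` (`isAlgebraicGL_corootTwist`) with `χ_x ∘ corootTwist = χ_{∑_j ⟨x, α_j^∨⟩ α_j}`
  (`charOfWeight_corootTwist`); its image `corootTwistTorus` is a subtorus of `T`
  (`isTorusSubgroup_corootTwistTorus`) on which **no root is trivial** (`charOfWeight_root_corootTwist_ne`:
  `∑_j ⟨α, α_j^∨⟩ α_j ≠ 0` by the independence of the simple roots and `⟨α, α^∨⟩ = 2`);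
* `diagSL2_eq_word` — `diag(s, s⁻¹) = u⁺(s) u⁻(-s⁻¹) u⁺(s) u⁺(-1) u⁻(1) u⁺(-1)` in `SL₂`, so an element
  commuting with the `φ_i (u^±(x))` commutes with the `α_i^∨ (s)` and with `corootTwistTorus`
  (`mem_centralizer_corootTwistTorus`);
* **`centralizer_corootTwistTorus_eq`** — `Z_G(S) = T` for `S = corootTwistTorus`: `Z_G(S)` is
  connected reductive (Springer 7.6.4 (i), `isConnectedReductive_centralizer_torus_holds`) with maximal
  torus `T` and no roots (a root subgroup of `Z_G(S)` is a root subgroup `U_α` of `G` centralising `S`,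
  forcing `α|_S = 1`), hence equals `T` by the generation theorem
  (`torus_sup_rootSubgroups_eq_of_lieWeights_subset`);
* **`mem_torus_of_forall_commute_rootSL2`** — consequently an element of `G` commuting with all
  `φ_i (u^±(x))` lies in `T`.

Everything is proved; no named fact is introduced.

## References

* [SpringerLAG1998] T. A. Springer, *Linear Algebraic Groups*, 2nd ed. (1998), 7.6.4, 8.1.1, 8.1.5, 9.6.2.
-/

noncomputable section

open scoped MatrixGroups IsMulCommutative
open Set

namespace Literature.NumberTheory.Automorphic

/-! ### An `SL₂` word for the diagonal -/

section SL2

variable {R : Type*} [CommRing R]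

/-- **`diag(s, s⁻¹) = u⁺(s) u⁻(-s⁻¹) u⁺(s) · u⁺(-1) u⁻(1) u⁺(-1)`** in `SL₂` (Steinberg's
`h(s) = w(s) w(1)⁻¹`). [folklore] -/
theorem diagSL2_eq_word (s : Rˣ) :
    diagSL2 s = unipotentUpperSL2 (Multiplicative.ofAdd (s : R)) * unipotentLowerSL2 (Multiplicative.ofAdd (-(s⁻¹ : Rˣ) : R)) *
      unipotentUpperSL2 (Multiplicative.ofAdd (s : R)) *
      (unipotentUpperSL2 (Multiplicative.ofAdd (-1 : R)) * unipotentLowerSL2 (Multiplicative.ofAdd (1 : R)) *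
        unipotentUpperSL2 (Multiplicative.ofAdd (-1 : R))) := by
  apply Subtype.ext
  simp only [coe_diagSL2, Matrix.SpecialLinearGroup.coe_mul]
  change _ = !![1, (s : R); 0, 1] * !![1, 0; -((s⁻¹ : Rˣ) : R), 1] * !![1, (s : R); 0, 1] *
    (!![1, (-1 : R); 0, 1] * !![1, 0; (1 : R), 1] * !![1, (-1 : R); 0, 1])
  ext i j
  fin_cases i <;> fin_cases j <;> simp [Matrix.mul_apply, Fin.sum_univ_two]

end SL2

section Main

variable {k : Type*} [Field k] [IsAlgClosed k] [CharZero k] {n : Type*} [Fintype n] [DecidableEq n]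
variable {ι X Y : Type*} [AddCommGroup X] [AddCommGroup Y] [Fintype ι] [DecidableEq ι]
variable {G T : Subgroup (GL n k)} [IsMulCommutative ↥T]
variable {P : RootPairing ι ℤ X Y} {eX : Additive ↥(characterLattice T) ≃+ X}
  {eY : Additive ↥(cocharacterLattice T) ≃+ Y}
variable (h : IsRootDatumOf G T P eX eY) (b : P.Base)

/-- **The coroot twist `t ↦ ∏_{j ∈ b} α_j^∨ (χ_{α_j} (t))`**, an endomorphism of `T`. [folklore] -/
def corootTwist : ↥T →* ↥T :=
  ∏ j ∈ b.support, (cocharOfCoweight eY (P.coroot j)).comp (charOfWeight eX (P.root j))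

omit [IsAlgClosed k] [CharZero k] [Fintype ι] [DecidableEq ι] in
/-- Unfolding of `corootTwist`. [folklore] -/
lemma corootTwist_apply (t : ↥T) :
    corootTwist (eX := eX) (eY := eY) b t = ∏ j ∈ b.support, cocharOfCoweight eY (P.coroot j) (charOfWeight eX (P.root j) t) := by
  simp [corootTwist]

/-- The lattice map `x ↦ ∑_j ⟨x, α_j^∨⟩ α_j` dual to the coroot twist. [folklore] -/
def twistWt (x : X) : X := ∑ j ∈ b.support, (P.toLinearMap x (P.coroot j)) • P.root j

include h in
omit [CharZero k] [Fintype ι] [DecidableEq ι] in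
/-- `χ_x (∏_{j ∈ s} α_j^∨ (χ_{α_j} t)) = χ_{∑_{j ∈ s} ⟨x, α_j^∨⟩ α_j} (t)`. [cite: SpringerLAG1998, 3.2.11] -/
lemma charOfWeight_prod_cochar (x : X) (t : ↥T) (s : Finset ι) :
    charOfWeight eX x (∏ j ∈ s, cocharOfCoweight eY (P.coroot j) (charOfWeight eX (P.root j) t)) =
      charOfWeight eX (∑ j ∈ s, (P.toLinearMap x (P.coroot j)) • P.root j) t := by
  classical
  haveI : Infinite k := IsAlgClosed.instInfinite
  induction s using Finset.induction_on with
  | empty => simp [charOfWeight]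
  | insert j s hj ih =>
    rw [Finset.prod_insert hj, Finset.sum_insert hj, charOfWeight_add', MonoidHom.mul_apply, map_mul, ih,
      h.charOfWeight_cocharOfCoweight, charOfWeight_zsmul, MonoidHom.zpow_apply]

include h in
omit [CharZero k] [Fintype ι] [DecidableEq ι] in
/-- **`χ_x (corootTwist t) = χ_{twistWt x} (t)`.** [cite: SpringerLAG1998, 3.2.11] -/
theorem charOfWeight_corootTwist (x : X) (t : ↥T) :
    charOfWeight eX x (corootTwist (eX := eX) (eY := eY) b t) = charOfWeight eX (twistWt b x) t := by
  rw [corootTwist_apply, twistWt]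
  exact charOfWeight_prod_cochar h x t b.support

include h in
omit [CharZero k] [Fintype ι] [DecidableEq ι] in
/-- `corootTwist` is an algebraic endomorphism of the torus `T`. [cite: SpringerLAG1998, 3.2.3] -/
theorem isAlgebraicGL_corootTwist (hT : IsTorusSubgroup T) :
    MonoidHom.IsAlgebraicGL (T.subtype.comp (corootTwist (eX := eX) (eY := eY) b)) := by
  refine hT.isAlgebraicGL_of_isAlgebraicChar_comp _ fun χ hχ => ?_
  set x : X := eX (Additive.ofMul ⟨χ, hχ⟩) with hx
  have hχx : χ = (charOfWeight eX x : ↥T →* kˣ) := by simp [charOfWeight, hx]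
  have : χ.comp (corootTwist (eX := eX) (eY := eY) b) = charOfWeight eX (twistWt b x) := by
    ext t
    rw [MonoidHom.comp_apply, hχx, charOfWeight_corootTwist h b x t]
  rw [this]
  exact (Additive.toMul (eX.symm (twistWt b x))).2

/-- **The subtorus `S = Im (corootTwist)` of `T`.** [folklore] -/
def corootTwistTorus : Subgroup (GL n k) := (T.subtype.comp (corootTwist (eX := eX) (eY := eY) b)).range

omit [IsAlgClosed k] [CharZero k] [Fintype ι] [DecidableEq ι] in
/-- `S ≤ T`. [folklore] -/
lemma corootTwistTorus_le : corootTwistTorus (eX := eX) (eY := eY) b ≤ T := by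
  rintro _ ⟨t, rfl⟩; exact (corootTwist b t).2

include h in
omit [CharZero k] [Fintype ι] [DecidableEq ι] in
/-- `S` is a torus. [cite: SpringerLAG1998, 2.2.5 (ii) and 3.2.7] -/
theorem isTorusSubgroup_corootTwistTorus (hT : IsTorusSubgroup T) :
    IsTorusSubgroup (corootTwistTorus (eX := eX) (eY := eY) b) := by
  have hcommS : IsMulCommutative ↥(corootTwistTorus (eX := eX) (eY := eY) b) := ⟨⟨fun a c => by
    have := hT.2.1.is_comm.comm ⟨a.1, corootTwistTorus_le b a.2⟩ ⟨c.1, corootTwistTorus_le b c.2⟩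
    have e : (a : GL n k) * c = c * a := congrArg Subtype.val this
    exact Subtype.ext e⟩⟩
  exact ⟨(isAlgebraicGL_corootTwist h b hT).isZConnected_range hT.1, hcommS,
    fun t ht => hT.2.2 t (corootTwistTorus_le b ht)⟩

omit [IsAlgClosed k] [CharZero k] [Fintype ι] [DecidableEq ι] [IsMulCommutative ↥T] in
/-- **No root is trivial on `S`**: `twistWt α = ∑_j ⟨α, α_j^∨⟩ α_j ≠ 0` for a root `α`.
[cite: SpringerLAG1998, 8.1.8] -/
theorem twistWt_root_ne_zero (l : ι) : twistWt b (P.root l) ≠ 0 := by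
  intro h0
  -- independence of the simple roots: all `⟨α_l, α_j^∨⟩ = 0`
  have hcoef : ∀ j : ↥b.support, P.toLinearMap (P.root l) (P.coroot j) = 0 := by
    have hli := b.linearIndepOn_root
    have hsum : ∑ j : ↥b.support, (P.toLinearMap (P.root l) (P.coroot j)) • P.root (j : ι) = 0 := by
      rw [Finset.univ_eq_attach, Finset.sum_attach b.support (fun j => (P.toLinearMap (P.root l) (P.coroot j)) • P.root j)]
      exact h0
    exact Fintype.linearIndependent_iff.1 hli _ hsum
  -- hence `⟨α_l, α^∨⟩ = 0` for every coroot, contradicting `⟨α_l, α_l^∨⟩ = 2`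
  have hall := coroot'_eq_zero_of_forall_support b (x := P.root l) (fun j hj => hcoef ⟨j, hj⟩) l
  rw [RootPairing.root_coroot'_eq_pairing, RootPairing.pairing_same] at hall
  exact two_ne_zero hall

include h in
omit [CharZero k] [Fintype ι] [DecidableEq ι] in
/-- `χ_α` is non-trivial on `S`: there is `s ∈ S` with `χ_α (s) ≠ 1`. [cite: SpringerLAG1998, 8.1.8] -/
theorem exists_charOfWeight_root_ne_one (l : ι) :
    ∃ t : ↥T, charOfWeight eX (P.root l) (corootTwist (eX := eX) (eY := eY) b t) ≠ 1 := by
  by_contra hall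
  push Not at hall
  apply twistWt_root_ne_zero b l
  apply charOfWeight_injective eX
  refine MonoidHom.ext fun t => ?_
  rw [← charOfWeight_corootTwist h b, hall t]
  simp [charOfWeight]

/-! ### The centraliser of `S` is `T` -/

variable (hG : IsConnectedReductive G) (hT : IsMaximalTorusIn T G)

omit [Fintype ι] [DecidableEq ι] in
include hG hT h in
/-- **`Z_G(S) = T`** for the subtorus `S = corootTwistTorus`: the connected reductive group `Z_G(S)`
(Springer 7.6.4 (i)) with maximal torus `T` has no roots. [cite: SpringerLAG1998, 7.6.4 and 8.1.1] -/
theorem centralizer_corootTwistTorus_eq :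
    G ⊓ Subgroup.centralizer (corootTwistTorus (eX := eX) (eY := eY) b : Set (GL n k)) = T := by
  haveI : Infinite k := IsAlgClosed.instInfinite
  have hTt : IsTorusSubgroup T := hT.2.1
  set S := corootTwistTorus (eX := eX) (eY := eY) b with hS
  set M := G ⊓ Subgroup.centralizer (S : Set (GL n k)) with hM
  have hSt : IsTorusSubgroup S := isTorusSubgroup_corootTwistTorus h b hTt
  have hSG : S ≤ G := (corootTwistTorus_le b).trans hT.1
  have hMred : IsConnectedReductive M := isConnectedReductive_centralizer_torus_holds hG hSG hSt
  -- `T ≤ M` and `T` is a maximal torus of `M`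
  have hTM : T ≤ M := fun t ht => ⟨hT.1 ht, Subgroup.mem_centralizer_iff.2 fun s hs =>
    congrArg Subtype.val (hTt.2.1.is_comm.comm (⟨s, corootTwistTorus_le b hs⟩ : ↥T) ⟨t, ht⟩)⟩
  have hTmax : IsMaximalTorusIn T M :=
    ⟨hTM, hTt, fun T' hTT' hT'M hT't => hT.2.2 T' hTT' (hT'M.trans inf_le_left) hT't⟩
  -- `M` has no roots with respect to `T`
  have hroots : roots M T = ∅ := by
    ext β
    simp only [Set.mem_empty_iff_false, iff_false]
    rintro ⟨hβ1, hTM', u, hu⟩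
    -- `u` is a root homomorphism of `G`, so `β = χ_α`
    have huG : IsRootHom G T hT.1 (β : ↥T →* kˣ) ((Subgroup.inclusion (inf_le_left : M ≤ G)).comp u) :=
      hu.mono inf_le_left hT.1
    have hβR : β ∈ roots G T := ⟨hβ1, hT.1, _, huG⟩
    have : eX (Additive.ofMul β) ∈ Set.range P.root := by rw [h.range_root]; exact ⟨β, hβR, rfl⟩
    obtain ⟨l, hl⟩ := this
    have hβl : (β : ↥T →* kˣ) = charOfWeight eX (P.root l) := by simp [charOfWeight, hl]
    -- `U_β ≤ M` centralises `S`, so `β|_S = 1`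
    obtain ⟨t, ht⟩ := exists_charOfWeight_root_ne_one h b l
    apply ht
    set s : ↥T := corootTwist (eX := eX) (eY := eY) b t with hs
    have hsS : (s : GL n k) ∈ S := ⟨t, rfl⟩
    have hconj := hu.2.2 s 1
    have hcomm : Subgroup.inclusion hTM' s * u (Multiplicative.ofAdd 1) * (Subgroup.inclusion hTM' s)⁻¹ =
        u (Multiplicative.ofAdd 1) := by
      apply Subtype.ext
      have hz : ((u (Multiplicative.ofAdd (1 : k)) : ↥M) : GL n k) ∈ Subgroup.centralizer (S : Set (GL n k)) :=
        (u (Multiplicative.ofAdd (1 : k))).2.2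
      have e := Subgroup.mem_centralizer_iff.1 hz _ hsS
      simp only [Subgroup.coe_mul, Subgroup.coe_inv, Subgroup.coe_inclusion]
      rw [e, mul_inv_cancel_right]
    rw [hcomm, mul_one] at hconj
    have hinj := hu.injective hconj
    have e1 : (1 : k) = (((β : ↥T →* kˣ) s : kˣ) : k) := by
      have := Multiplicative.ofAdd.injective hinj
      simpa using this
    rw [hβl] at e1
    exact Units.val_eq_one.1 e1.symm
  -- generation: `M = T ⊔ ⨆_{∅} = T`
  have hgen := torus_sup_rootSubgroups_eq_of_lieWeights_subset hMred.1 hTt hTM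
    (by rw [lieWeights_eq_roots_of_charZero hMred.1.1 hTt.1 hTM])
    (fun α hα => by rw [hroots] at hα; exact absurd hα (Set.notMem_empty _))
    (lieWeightSpace_one_le_lieAlgebraGL_holds M T hMred hTmax)
  rw [hroots] at hgen
  simp only [Set.mem_empty_iff_false, iSup_false, iSup_bot, sup_bot_eq] at hgen
  exact hgen.symm

include hG hT h in
/-- **An element of `G` commuting with all `φ_i (u⁺(x))`, `φ_i (u⁻(x))` lies in `T`.**
[cite: SpringerLAG1998, 7.6.4 and 9.6.2] -/
theorem mem_torus_of_forall_commute_rootSL2 {z : GL n k} (hz : z ∈ G)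
    (hzU : ∀ (j : ι) (x : k), Commute z ((h.rootSL2 j (unipotentUpperSL2 (Multiplicative.ofAdd x)) : ↥G) : GL n k))
    (hzL : ∀ (j : ι) (x : k), Commute z ((h.rootSL2 j (unipotentLowerSL2 (Multiplicative.ofAdd x)) : ↥G) : GL n k)) :
    z ∈ T := by
  haveI : P.IsReduced := isReduced_of_isRootDatumOf_holds hG hT h
  obtain ⟨b⟩ := P.nonempty_base_int
  rw [← centralizer_corootTwistTorus_eq h b hG hT]
  refine ⟨hz, Subgroup.mem_centralizer_iff.2 ?_⟩
  -- `z` commutes with each `α_j^∨ (s) = φ_j (diag(s, s⁻¹))`, a word in the `φ_j (u^±)`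
  have hdiag : ∀ (j : ι) (s : kˣ), Commute z ((cocharOfCoweight eY (P.coroot j) s : ↥T) : GL n k) := by
    intro j s
    have e : ((cocharOfCoweight eY (P.coroot j) s : ↥T) : GL n k) = ((h.rootSL2 j (diagSL2 s) : ↥G) : GL n k) := by
      rw [h.rootSL2_diagSL2]; rfl
    rw [e, diagSL2_eq_word]
    simp only [map_mul, Subgroup.coe_mul]
    exact ((((hzU j _).mul_right (hzL j _)).mul_right (hzU j _)).mul_right
      (((hzU j _).mul_right (hzL j _)).mul_right (hzU j _)))
  rintro _ ⟨t, rfl⟩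
  have key : ∀ s : Finset ι,
      Commute z ((∏ j ∈ s, cocharOfCoweight eY (P.coroot j) (charOfWeight eX (P.root j) t) : ↥T) : GL n k) := by
    intro s
    induction s using Finset.induction_on with
    | empty => simp
    | insert j s hj ih => rw [Finset.prod_insert hj, Subgroup.coe_mul]; exact (hdiag j _).mul_right ih
  change ((T.subtype.comp (corootTwist b)) t : GL n k) * z = z * _
  rw [MonoidHom.comp_apply, Subgroup.coe_subtype, corootTwist_apply]
  exact (key b.support).symm.eq

end Main

end Literature.NumberTheory.Automorphic
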